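import Literature.Probability.Percolation.KozmaNitzanPreFKG
import Literature.Barriers.PneNP.TSPExtensionComplexityFarkas
import HarnessLib

/-!
# Kozma–Nitzan's Conjecture 4 is a uniform-coefficient statement; it implies a positive answer to their Question 5

Source: G. Kozma, S. Nitzan, *A reduction of the `θ(p_c) = 0` problem to a conjectured inequality*,
arXiv:2401.12397 (2024), §5.1 (pp. 31–32: monotone cluster properties, **Conjecture 4**) and §5.2
(pp. 32–33: **Question 5** on `b`-independent coefficients, Theorem 11).

Printed statements.  A *monotone cluster property* is `f(v, ω) = F(C_ω(v))` with `F` increasing in the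
cluster (p. 31).  **Conjecture 4** (p. 32): for any finite weighted graph `G`, any monotone cluster
property `f`, any `A ⊂ G` and any `0 ∈ G`, `E(f(0)·𝟙{0 ↔ A}) ≥ min_{a∈A} E(f(a)·𝟙{0 ↔ A})`.
**Question 5** (p. 32): "Is it true that for any graph `G`, any `A ⊂ G` and any `0 ∈ G` there are
nonnegative coefficients `(c_a : a ∈ A)` with `∑ c_a = 1` such that
`P(0 ↔ b) ≥ ∑_{a∈A} c_a P(0 ↔ A, a ↔ b)` (38) holds for all `b ∈ G`?  If true, this will, of course,
imply conjecture 2."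

## What is proved here (new; finite graphs, arbitrary edge weights)

For a finite vertex type `V`, weights `w : Sym2 V → [0,1]`, `μ = prodBernoulli w`, a target set `A` and a
source `o`, write `m_x(S) = μ(C(x) = S, o ↔ A)` for the (sub-probability) law of the vertex cluster of `x`
on the event `{o ↔ A}` and `E_F(x) = ∑_S F(S) m_x(S) = E(F(C(x)) 𝟙{o ↔ A})` (a finite sum: the graph is
finite).

* `exists_convex_weights_of_forall_exists` — the LP-duality core (a Ville/von Neumann alternative, from the
  tree's conic Farkas lemma `Literature.Barriers.PneNP.farkas`): for a real matrix `D : I × A` with `I, A`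
  finite, if every nonnegative row combination has a nonnegative entry, `∀ λ ≥ 0, ∃ a, ∑_i λ_i D_{ia} ≥ 0`,
  then some probability vector `c` on `A` has `∑_a c_a D_{ia} ≥ 0` for EVERY row `i`.
* `KNConj4Real` (Conjecture 4 at `(G, A, o)`, real-valued `F`), `KNUniformUpsets` (ONE probability vector
  `c` on `A` with `∑_a c_a μ(C(a) ∈ 𝒰, o ↔ A) ≤ μ(C(o) ∈ 𝒰, o ↔ A)` for every up-set `𝒰` of vertex sets),
  `KNQuestion5Strong` / `KNQuestion5` (the coefficients of Question 5, with left side `P(o ↔ b, o ↔ A)` /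
  `P(o ↔ b)`), `KNConj2All` (inequality (2) of p. 3 at `(G, A, o)` for every `b`).
* `knUniformUpsets_of_conj4Real` : `KNConj4Real w A o → KNUniformUpsets w A o` — Conjecture 4 (at a given
  `(G, A, o)`, for real-valued monotone cluster properties) FORCES coefficients that do not depend on the
  property; in particular (`knQuestion5Strong_of_uniformUpsets`, `knQuestion5_of_strong`) it forces a
  positive answer to Question 5 at `(G, A, o)`, which in turn gives Conjecture 2 there for every `b`
  (`knConj2All_of_question5`).  Conversely `knConj4Event_of_uniformUpsets`: uniform coefficients give
  Conjecture 4 back for every `{0,1}`-valued monotone cluster property (the event form).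
  The full converse for real-valued `F` (layer cake) — hence `KNConj4Real ↔ KNUniformUpsets` — is in the
  companion file `SoloBlindKNLayerCake.lean`.
  Contrapositive, used by the accompanying computation (HOME/work/kn_q5, job j040872): an instance
  `(G, A, o)` at which the linear feasibility problem `KNUniformUpsets` (or already `KNQuestion5`) has no
  solution refutes Conjecture 4, with the Farkas multipliers as an explicit monotone cluster property.

No sorry, no new axioms.  This file does not touch `ℤ^d`; it is a structural remark on the finite-graph
inequalities through which [KozmaNitzan2024] reduce `θ(p_c) = 0`.
-/

noncomputable section

open MeasureTheory Set Finset
open scoped BigOperators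
open Literature.Probability.LatticeModels (prodBernoulli)
open Literature.Probability.Percolation

namespace Summit.CriticalPhenomena.PercolationContinuityZ3.Theorems.SoloBlindKN

/-! ### The LP-duality core -/

/-- **Uniform weights from a pointwise alternative** (von Neumann / Ville form of LP duality).  Let
`D : I → A → ℝ` with `I`, `A` finite.  If for every `λ : I → ℝ≥0` some column `a` has
`0 ≤ ∑_i λ_i D i a`, then there is a probability vector `c` on `A` with `0 ≤ ∑_a c_a D i a` for every
row `i`.  Proof: apply the conic Farkas alternative to the generators `(D·a, 1)` (`a ∈ A`) and
`(-e_i, 0)` (`i ∈ I`) and the target `(0, 1)`; the alternative vector `y` would be a nonnegative row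
combination all of whose column sums are negative. -/
theorem exists_convex_weights_of_forall_exists {I A : Type*} [Fintype I] [Fintype A]
    (D : I → A → ℝ) (h : ∀ lam : I → ℝ, (∀ i, 0 ≤ lam i) → ∃ a, 0 ≤ ∑ i, lam i * D i a) :
    ∃ c : A → ℝ, (∀ a, 0 ≤ c a) ∧ ∑ a, c a = 1 ∧ ∀ i, 0 ≤ ∑ a, c a * D i a := by
  classical
  -- coordinates `Option I` (`none` = the normalisation row), generators indexed by `A ⊕ I`
  let gen : A ⊕ I → Option I → ℝ := fun g =>
    match g with
    | Sum.inl a => fun o => match o with | none => 1 | some i => D i a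
    | Sum.inr i => fun o => match o with | none => 0 | some j => if j = i then -1 else 0
  let b : Option I → ℝ := fun o => match o with | none => 1 | some _ => 0
  rcases Literature.Barriers.PneNP.farkas gen b with ⟨lam, hlam, hb⟩ | ⟨y, hy, hby⟩
  · refine ⟨fun a => lam (Sum.inl a), fun a => hlam _, ?_, fun i => ?_⟩
    · have h1 := hb none
      simp only [b, gen, Fintype.sum_sum_type, mul_one, mul_zero, Finset.sum_const_zero,
        add_zero] at h1
      exact h1.symm
    · have h1 := hb (some i)
      have hsum : ∑ j, lam (Sum.inr j) * (if i = j then (-1 : ℝ) else 0) = -lam (Sum.inr i) := by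
        rw [Finset.sum_eq_single i (fun j _ hj => by simp [Ne.symm hj]) (fun hi => absurd (Finset.mem_univ i) hi)]
        simp
      simp only [b, gen, Fintype.sum_sum_type] at h1
      rw [hsum] at h1
      have : ∑ a, lam (Sum.inl a) * D i a = lam (Sum.inr i) := by linarith
      rw [this]; exact hlam _
  · exfalso
    have hyi : ∀ i, y (some i) ≤ 0 := by
      intro i
      have := hy (Sum.inr i)
      simp only [gen, dotProduct, Fintype.sum_option, zero_mul, zero_add, ite_mul, neg_mul, one_mul,
        Finset.sum_ite_eq', Finset.mem_univ, if_true] at this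
      linarith
    have hb0 : y none < 0 := by
      simpa [b, dotProduct, Fintype.sum_option] using hby
    obtain ⟨a, ha⟩ := h (fun i => - y (some i)) (fun i => by linarith [hyi i])
    have hga := hy (Sum.inl a)
    simp only [gen, dotProduct, Fintype.sum_option, one_mul] at hga
    have : ∑ i, -y (some i) * D i a = -∑ i, D i a * y (some i) := by
      rw [← Finset.sum_neg_distrib]; refine Finset.sum_congr rfl fun i _ => by ring
    rw [this] at ha
    linarith


/-! ### An averaging lemma -/

/-- If a convex combination of the `e a` (`a ∈ A`) is `≤ t` then some `e a ≤ t`. [folklore] -/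
theorem exists_le_of_convexComb_le {V : Type*} {A : Finset V} {c e : V → ℝ} {t : ℝ}
    (hc : ∀ a, 0 ≤ c a) (hs : ∑ a ∈ A, c a = 1) (h : ∑ a ∈ A, c a * e a ≤ t) :
    ∃ a ∈ A, e a ≤ t := by
  by_contra hne
  push Not at hne
  have hpos : ∃ a ∈ A, 0 < c a := by
    by_contra h0
    push Not at h0
    have : ∑ a ∈ A, c a = 0 :=
      Finset.sum_eq_zero fun a ha => le_antisymm (h0 a ha) (hc a)
    linarith
  have hlt : ∑ a ∈ A, c a * t < ∑ a ∈ A, c a * e a := by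
    refine Finset.sum_lt_sum (fun a ha => mul_le_mul_of_nonneg_left (hne a ha).le (hc a)) ?_
    obtain ⟨a, ha, hca⟩ := hpos
    exact ⟨a, ha, mul_lt_mul_of_pos_left (hne a ha) hca⟩
  rw [← Finset.sum_mul, hs, one_mul] at hlt
  linarith

/-! ### The finite-graph objects -/

section Percolation

variable {V : Type*} [Fintype V]

/-- The event `{o ↔ A} = ⋃_{a ∈ A} {o ↔ a}` (as in `KozmaNitzan2024_thm1`). [cite: KozmaNitzan2024, p. 3] -/
def connTo (o : V) (A : Finset V) : Set (BondConfig V) := ⋃ a ∈ A, openConn o a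

/-- Point masses of the law of the vertex cluster of `x` on `{o ↔ A}`:
`m_x(S) = μ(C(x) = S, o ↔ A)`. [cite: KozmaNitzan2024, §5.1 (p. 31)] -/
def clusterPM (w : Sym2 V → unitInterval) (A : Finset V) (o x : V) (S : Set V) : ℝ :=
  (prodBernoulli w).real ({ω | openCluster ω x = S} ∩ connTo o A)

/-- `E_F(x) = E(F(C(x)) 𝟙{o ↔ A}) = ∑_S F(S) μ(C(x) = S, o ↔ A)` for a cluster functional
`F : Set V → ℝ` (a finite sum: `V` is finite). [cite: KozmaNitzan2024, §5.1 (pp. 31–32)] -/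
def clusterExp (w : Sym2 V → unitInterval) (A : Finset V) (o : V) (F : Set V → ℝ) (x : V) : ℝ :=
  ∑ S : Set V, F S * clusterPM w A o x S

/-- The indicator functional of a family `𝒰` of vertex sets. -/
def setInd (𝒰 : Set (Set V)) (S : Set V) : ℝ := by
  classical exact if S ∈ 𝒰 then 1 else 0

/-- **Kozma–Nitzan's Conjecture 4 at `(G, A, o)`** for real-valued monotone cluster properties
`f(v, ω) = F(C_ω(v))`, `F` increasing (p. 31 (1)–(2); (2) is automatic for a function of the vertex
cluster): `E(F(C(o)) 𝟙{o↔A}) ≥ min_{a ∈ A} E(F(C(a)) 𝟙{o↔A})`, the minimum over the finite set `A`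
written as an existential.  A CONJECTURE in print — recorded as a `Prop`, never assumed.
[cite: KozmaNitzan2024, Conjecture 4 (p. 32)] -/
def KNConj4Real (w : Sym2 V → unitInterval) (A : Finset V) (o : V) : Prop :=
  ∀ F : Set V → ℝ, Monotone F → ∃ a ∈ A, clusterExp w A o F a ≤ clusterExp w A o F o

/-- **Conjecture 4 at `(G, A, o)` in event form** (`{0,1}`-valued monotone cluster properties = indicators
of up-sets `𝒰` of vertex sets): `μ(C(o) ∈ 𝒰, o ↔ A) ≥ min_a μ(C(a) ∈ 𝒰, o ↔ A)`.
[cite: KozmaNitzan2024, Conjecture 4 (p. 32)] -/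
def KNConj4Event (w : Sym2 V → unitInterval) (A : Finset V) (o : V) : Prop :=
  ∀ 𝒰 : Set (Set V), IsUpperSet 𝒰 →
    ∃ a ∈ A, clusterExp w A o (setInd 𝒰) a ≤ clusterExp w A o (setInd 𝒰) o

/-- **Uniform coefficients for Conjecture 4 at `(G, A, o)`**: ONE probability vector `c` on `A` with
`∑_a c_a μ(C(a) ∈ 𝒰, o ↔ A) ≤ μ(C(o) ∈ 𝒰, o ↔ A)` for EVERY up-set `𝒰` of vertex sets. (New notion.) -/
def KNUniformUpsets (w : Sym2 V → unitInterval) (A : Finset V) (o : V) : Prop :=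
  ∃ c : V → ℝ, (∀ a, 0 ≤ c a) ∧ ∑ a ∈ A, c a = 1 ∧
    ∀ 𝒰 : Set (Set V), IsUpperSet 𝒰 →
      ∑ a ∈ A, c a * clusterExp w A o (setInd 𝒰) a ≤ clusterExp w A o (setInd 𝒰) o

/-- **The coefficients of Kozma–Nitzan's Question 5 at `(G, A, o)`, strong form** (left side
`P(o ↔ b, o ↔ A)`): `∃ c ≥ 0, ∑ c = 1, ∀ b, ∑_a c_a P(a ↔ b, o ↔ A) ≤ P(o ↔ b, o ↔ A)`.
[cite: KozmaNitzan2024, Question 5 and (38) (p. 32)] -/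
def KNQuestion5Strong (w : Sym2 V → unitInterval) (A : Finset V) (o : V) : Prop :=
  ∃ c : V → ℝ, (∀ a, 0 ≤ c a) ∧ ∑ a ∈ A, c a = 1 ∧
    ∀ b : V, ∑ a ∈ A, c a * (prodBernoulli w).real (openConn a b ∩ connTo o A) ≤
      (prodBernoulli w).real (openConn o b ∩ connTo o A)

/-- **Kozma–Nitzan's Question 5 at `(G, A, o)`** (inequality (38), p. 32): "there are nonnegative
coefficients `(c_a : a ∈ A)` with `∑ c_a = 1` such that `P(0 ↔ b) ≥ ∑_{a∈A} c_a P(0 ↔ A, a ↔ b)` holds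
for all `b ∈ G`" — the coefficients NOT depending on `b`.  An open QUESTION in print, recorded as a `Prop`.
[cite: KozmaNitzan2024, Question 5 (p. 32)] -/
def KNQuestion5 (w : Sym2 V → unitInterval) (A : Finset V) (o : V) : Prop :=
  ∃ c : V → ℝ, (∀ a, 0 ≤ c a) ∧ ∑ a ∈ A, c a = 1 ∧
    ∀ b : V, ∑ a ∈ A, c a * (prodBernoulli w).real (openConn a b ∩ connTo o A) ≤
      (prodBernoulli w).real (openConn o b)

/-- **Kozma–Nitzan's Conjecture 2 at `(G, A, o)`, for every `b`** (inequality (2), p. 3: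
"`P(0 ↔ b) ≥ min{P(0 ↔ A, a ↔ b) : a ∈ A}`"), in the shape of `KozmaNitzan2024_thm4_preFKG2`.
[cite: KozmaNitzan2024, Conjecture 2 (p. 3)] -/
def KNConj2All (w : Sym2 V → unitInterval) (A : Finset V) (o : V) : Prop :=
  ∀ b : V, ∃ a ∈ A, (prodBernoulli w).real (openConn a b ∩ connTo o A) ≤ (prodBernoulli w).real (openConn o b)

/-! ### Bookkeeping: indicators, linearity, the bridge to events -/

omit [Fintype V] in
/-- Unfolding `setInd` at a decidable membership. -/
theorem setInd_apply (𝒰 : Set (Set V)) (S : Set V) [Decidable (S ∈ 𝒰)] :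
    setInd 𝒰 S = if S ∈ 𝒰 then 1 else 0 := by
  unfold setInd; congr

omit [Fintype V] in
/-- The indicator of an up-set of vertex sets is an increasing cluster functional. -/
theorem monotone_setInd {𝒰 : Set (Set V)} (h𝒰 : IsUpperSet 𝒰) : Monotone (setInd 𝒰) := by
  classical
  intro S T hST
  rw [setInd_apply, setInd_apply]
  by_cases hS : S ∈ 𝒰
  · rw [if_pos hS, if_pos (h𝒰 hST hS)]
  · rw [if_neg hS]; split_ifs <;> norm_num

omit [Fintype V] in
/-- Point masses are nonnegative. -/
theorem clusterPM_nonneg (w : Sym2 V → unitInterval) (A : Finset V) (o x : V) (S : Set V) :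
    0 ≤ clusterPM w A o x S := measureReal_nonneg

/-- Linearity of `E_F(x)` in `F` over finite nonnegative… (any) combinations. -/
theorem clusterExp_sum_smul {I : Type*} (s : Finset I) (lam : I → ℝ) (F : I → Set V → ℝ)
    (w : Sym2 V → unitInterval) (A : Finset V) (o x : V) :
    clusterExp w A o (fun S => ∑ i ∈ s, lam i * F i S) x = ∑ i ∈ s, lam i * clusterExp w A o (F i) x := by
  unfold clusterExp
  simp_rw [Finset.sum_mul, Finset.mul_sum]
  rw [Finset.sum_comm]
  refine Finset.sum_congr rfl fun i _ => Finset.sum_congr rfl fun S _ => by ring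

/-- **Bridge to events**: `E_{𝟙_𝒰}(x) = μ(C(x) ∈ 𝒰, o ↔ A)` (finite additivity over the values of
`C(x)`). -/
theorem clusterExp_setInd (w : Sym2 V → unitInterval) (A : Finset V) (o x : V) (𝒰 : Set (Set V)) :
    clusterExp w A o (setInd 𝒰) x = (prodBernoulli w).real ({ω | openCluster ω x ∈ 𝒰} ∩ connTo o A) := by
  classical
  unfold clusterExp
  have h1 : ∑ S : Set V, setInd 𝒰 S * clusterPM w A o x S =
      ∑ S ∈ Finset.univ.filter (fun S : Set V => S ∈ 𝒰), clusterPM w A o x S := by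
    rw [Finset.sum_filter]
    refine Finset.sum_congr rfl fun S _ => ?_
    rw [setInd_apply]; split_ifs <;> simp
  rw [h1]
  have hdisj : Set.PairwiseDisjoint (↑(Finset.univ.filter (fun S : Set V => S ∈ 𝒰)) : Set (Set V))
      fun S => {ω : BondConfig V | openCluster ω x = S} ∩ connTo o A := by
    intro S _ S' _ hne
    rw [Function.onFun, Set.disjoint_left]
    rintro ω ⟨hS, -⟩ ⟨hS', -⟩
    exact hne (hS.symm.trans hS')
  have hU : (prodBernoulli w).real (⋃ S ∈ Finset.univ.filter (fun S : Set V => S ∈ 𝒰),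
      ({ω : BondConfig V | openCluster ω x = S} ∩ connTo o A)) =
      ∑ S ∈ Finset.univ.filter (fun S : Set V => S ∈ 𝒰), clusterPM w A o x S :=
    measureReal_biUnion_finset hdisj fun S _ => MeasurableSet.of_discrete
  rw [← hU]
  congr 1
  ext ω
  simp only [mem_iUnion, mem_inter_iff, mem_setOf_eq, Finset.mem_filter, Finset.mem_univ, true_and,
    exists_prop]
  constructor
  · rintro ⟨S, hS, hC, hA⟩; exact ⟨hC ▸ hS, hA⟩
  · rintro ⟨h, hA⟩; exact ⟨_, h, rfl, hA⟩

omit [Fintype V] in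
/-- `{C(x) ∋ b} = {x ↔ b}`. -/
theorem setOf_mem_openCluster (x b : V) :
    {ω : BondConfig V | openCluster ω x ∈ {S : Set V | b ∈ S}} = openConn x b := by
  ext ω; rfl

omit [Fintype V] in
/-- `{S ∣ b ∈ S}` is an up-set. -/
theorem isUpperSet_containing (b : V) : IsUpperSet {S : Set V | b ∈ S} :=
  fun _ _ hST hb => hST hb

/-! ### The implications -/

/-- **Conjecture 4 forces uniform coefficients.**  If Conjecture 4 holds at `(G, A, o)` for every
real-valued monotone cluster property, then ONE probability vector `c` on `A` satisfies
`∑_a c_a μ(C(a) ∈ 𝒰, o ↔ A) ≤ μ(C(o) ∈ 𝒰, o ↔ A)` simultaneously for all up-sets `𝒰`.  (LP duality: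
`exists_convex_weights_of_forall_exists` applied to the matrix `D_{𝒰,a} = E_{𝟙_𝒰}(o) - E_{𝟙_𝒰}(a)`, the
hypothesis being Conjecture 4 for the monotone functional `F = ∑_𝒰 λ_𝒰 𝟙_𝒰`.) (New.) -/
theorem knUniformUpsets_of_conj4Real (w : Sym2 V → unitInterval) (A : Finset V) (o : V)
    (h : KNConj4Real w A o) : KNUniformUpsets w A o := by
  classical
  let I := {𝒰 : Set (Set V) // IsUpperSet 𝒰}
  let D : I → A → ℝ := fun i a => clusterExp w A o (setInd i.1) o - clusterExp w A o (setInd i.1) a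
  have hD : ∀ lam : I → ℝ, (∀ i, 0 ≤ lam i) → ∃ a, 0 ≤ ∑ i, lam i * D i a := by
    intro lam hlam
    let F : Set V → ℝ := fun S => ∑ i, lam i * setInd i.1 S
    have hF : Monotone F := by
      intro S T hST
      exact Finset.sum_le_sum fun i _ => mul_le_mul_of_nonneg_left (monotone_setInd i.2 hST) (hlam i)
    obtain ⟨a, ha, hle⟩ := h F hF
    refine ⟨⟨a, ha⟩, ?_⟩
    have eo := clusterExp_sum_smul Finset.univ lam (fun i => setInd i.1) w A o o
    have ea := clusterExp_sum_smul Finset.univ lam (fun i => setInd i.1) w A o a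
    change clusterExp w A o F a ≤ clusterExp w A o F o at hle
    rw [eo, ea] at hle
    have : ∑ i, lam i * D i ⟨a, ha⟩ =
        ∑ i, lam i * clusterExp w A o (setInd i.1) o - ∑ i, lam i * clusterExp w A o (setInd i.1) a := by
      rw [← Finset.sum_sub_distrib]
      exact Finset.sum_congr rfl fun i _ => by ring
    rw [this]; linarith
  obtain ⟨c, hc0, hc1, hcD⟩ := exists_convex_weights_of_forall_exists D hD
  refine ⟨fun v => if hv : v ∈ A then c ⟨v, hv⟩ else 0, fun v => ?_, ?_, ?_⟩
  · show 0 ≤ (if hv : v ∈ A then c ⟨v, hv⟩ else 0)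
    split_ifs with hv
    · exact hc0 _
    · exact le_rfl
  · rw [← Finset.sum_attach]
    rw [← hc1]
    exact Finset.sum_congr rfl fun a _ => by rw [dif_pos a.2]
  · intro 𝒰 h𝒰
    have key := hcD ⟨𝒰, h𝒰⟩
    have hsum : ∑ a ∈ A, (if hv : a ∈ A then c ⟨a, hv⟩ else 0) * clusterExp w A o (setInd 𝒰) a =
        ∑ a : A, c a * clusterExp w A o (setInd 𝒰) a := by
      rw [← Finset.sum_attach]
      exact Finset.sum_congr rfl fun a _ => by rw [dif_pos a.2]
    rw [hsum]
    have : ∑ a : A, c a * D ⟨𝒰, h𝒰⟩ a =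
        (∑ a : A, c a) * clusterExp w A o (setInd 𝒰) o - ∑ a : A, c a * clusterExp w A o (setInd 𝒰) a := by
      rw [Finset.sum_mul, ← Finset.sum_sub_distrib]
      exact Finset.sum_congr rfl fun a _ => by ring
    rw [this, hc1, one_mul] at key
    linarith

/-- **Uniform coefficients give Conjecture 4 back in event form** (by averaging). (New, easy direction.) -/
theorem knConj4Event_of_uniformUpsets (w : Sym2 V → unitInterval) (A : Finset V) (o : V)
    (h : KNUniformUpsets w A o) : KNConj4Event w A o := by
  obtain ⟨c, hc0, hc1, hc⟩ := h
  intro 𝒰 h𝒰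
  exact exists_le_of_convexComb_le hc0 hc1 (hc 𝒰 h𝒰)

/-- **Uniform coefficients answer Question 5 (strong form)**: take `𝒰 = {S ∣ b ∈ S}`. (New.) -/
theorem knQuestion5Strong_of_uniformUpsets (w : Sym2 V → unitInterval) (A : Finset V) (o : V)
    (h : KNUniformUpsets w A o) : KNQuestion5Strong w A o := by
  obtain ⟨c, hc0, hc1, hc⟩ := h
  refine ⟨c, hc0, hc1, fun b => ?_⟩
  have key := hc {S : Set V | b ∈ S} (isUpperSet_containing b)
  simp only [clusterExp_setInd, setOf_mem_openCluster] at key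
  exact key

omit [Fintype V] in
/-- The strong form of Question 5 implies the printed form (`P(o ↔ b, o ↔ A) ≤ P(o ↔ b)`). -/
theorem knQuestion5_of_strong (w : Sym2 V → unitInterval) (A : Finset V) (o : V)
    (h : KNQuestion5Strong w A o) : KNQuestion5 w A o := by
  obtain ⟨c, hc0, hc1, hc⟩ := h
  exact ⟨c, hc0, hc1, fun b => (hc b).trans
    (measureReal_mono (h₂ := measure_ne_top _ _) inter_subset_left)⟩

omit [Fintype V] in
/-- **"If true, this will, of course, imply conjecture 2"** (p. 33): a positive answer to Question 5
at `(G, A, o)` gives Conjecture 2 there for every `b` (averaging). [cite: KozmaNitzan2024, p. 33] -/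
theorem knConj2All_of_question5 (w : Sym2 V → unitInterval) (A : Finset V) (o : V)
    (h : KNQuestion5 w A o) : KNConj2All w A o := by
  obtain ⟨c, hc0, hc1, hc⟩ := h
  intro b
  exact exists_le_of_convexComb_le hc0 hc1 (hc b)

/-- **Conjecture 4 at `(G, A, o)` already answers Question 5 there** — the coefficients of (38) can be
taken independent of `b` (indeed independent of the cluster property). (New.) -/
theorem knQuestion5_of_conj4Real (w : Sym2 V → unitInterval) (A : Finset V) (o : V)
    (h : KNConj4Real w A o) : KNQuestion5 w A o :=
  knQuestion5_of_strong w A o (knQuestion5Strong_of_uniformUpsets w A o (knUniformUpsets_of_conj4Real w A o h))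

/-- Conjecture 4 at `(G, A, o)` gives Conjecture 2 at `(G, A, o)` for every `b`
(cf. p. 32: "Conjecture 2 follows from conjecture 4 by using the function `f(g) = 𝟙{g ↔ b}`"; here via
the uniform coefficients). [cite: KozmaNitzan2024, p. 32] -/
theorem knConj2All_of_conj4Real (w : Sym2 V → unitInterval) (A : Finset V) (o : V)
    (h : KNConj4Real w A o) : KNConj2All w A o :=
  knConj2All_of_question5 w A o (knQuestion5_of_conj4Real w A o h)


end Percolation


end Summit.CriticalPhenomena.PercolationContinuityZ3.Theorems.SoloBlindKN

end
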